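import Mathlib.Analysis.Calculus.FDeriv.Mul
import Mathlib.Analysis.Calculus.FDeriv.Add
import Mathlib.Analysis.Calculus.ContDiff.Basic
import Mathlib.Analysis.Calculus.ContDiff.Operations
import Mathlib.Analysis.InnerProductSpace.Calculus
import Mathlib.Analysis.InnerProductSpace.Basic
import Mathlib.LinearAlgebra.QuadraticForm.Signature
import HarnessLib

/-!
# The `J`-averaged Hessian ("Levi form") of products, of `|holomorphic|²` and of `‖affine‖²`, and
# the index bound `2 · sigNeg Q ≤ dim` (Voisin II, Prop. 1.19 / Lemma 1.20 — the calculus)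

Second brick of the Morse-theoretic input (Andreotti–Frankel, Voisin II Thm. 1.22) for
`Voisin2003_smoothHypersurface_algebraicClasses_eq_top_holds` (see
`HypersurfaceLefschetzFromVanishing.lean` and `ComplexHessianIndex.lean`).  C. Voisin, *Hodge Theory
and Complex Algebraic Geometry II* (CUP 2003), §1.2.1, proof of Prop. 1.19 (PDF p. 58 of the held
copy): the Hessian of the squared distance `h_A(x) = ‖x‖²_A` restricted to a complex submanifold is
`P + Re H` with `P` Hermitian positive and `H` complex bilinear, so that (Lemma 1.20: multiplication
by `i` changes the sign of `Re H`) at most `n = dim_ℂ` eigenvalues are negative.  We isolate the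
mechanism in the form it is consumed on the affine complement `U_F = {F ≠ 0} ⊂ ℂℙ^{m+1}` of a
projective hypersurface, where the Morse functions are the quotients
`g = (z^* A z)(z^* z)^{d-1} / |F(z)|²` read in an affine chart: for a real `C²` function `φ` on a
real normed space `E` with an operator `J` (multiplication by `i` in real coordinates) put

  `leviNum J φ x u = φ(x) · (D²φₓ(u, u) + D²φₓ(Ju, Ju)) - (Dφₓ u)² - (Dφₓ (Ju))²`

(`= 4 φ² ∂∂̄ log φ (u, ū)` when `φ > 0`).  Then (all PROVED here, elementary calculus):

* `leviNum_mul` — `leviNum (φ ψ) = φ² leviNum ψ + ψ² leviNum φ` (`log (φψ) = log φ + log ψ`);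
  `leviNum_pow_nonneg`;
* `leviNum_sq_add_sq_eq_zero` — `leviNum (a² + b²) = 0` when `a + i b` satisfies the
  Cauchy–Riemann relations to second order at `x` (`log |f|²` is pluriharmonic);
* `leviNum_norm_sq_affine`, `leviNum_norm_sq_affine_pos` — for `q = ‖b + L ·‖²` with `L` real-linear
  into a complex inner product space and `L (J u) = i · L u`:
  `leviNum q = 4 (‖b + L x‖² ‖L u‖² - |⟪b + L x, L u⟫|²) ≥ 0`, and `> 0` when `b + L x`, `L u` are
  `ℂ`-independent (Cauchy–Schwarz, equality case; Voisin's `⟨u, u⟩ > 0` term);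
* `hessian_add_hessian_pos_of_isCriticalPt` — if `N = h · P` near a critical point `x` of `h` with
  `h(x), P(x) > 0`, `leviNum P = 0` and `leviNum N > 0` at `(x, u)`, then
  `D²hₓ(u, u) + D²hₓ(Ju, Ju) > 0` (since `leviNum N = h² leviNum P + P² leviNum h = P² h (D²h(u,u) +
  D²h(Ju,Ju))` at a critical point);
* `two_mul_sigNeg_le_finrank` — Voisin's Lemma 1.20 in index form: if `Q u + Q (J u) > 0` for all
  `u ≠ 0` (`J` a linear automorphism), a negative-definite subspace `V` meets `J V` trivially, so
  `2 · sigNeg Q ≤ dim_ℝ E`.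

## References

* [VoisinHodgeII2003] C. Voisin, Hodge Theory and Complex Algebraic Geometry II (CUP 2003), §1.2.1
  Prop. 1.19 and Lemma 1.20 (PDF p. 58), §1.2.2 Thm. 1.22.
* [Milnor1963] J. Milnor, Morse theory (1963), §7, proof of Thm. 7.2 (the index estimate for the
  distance function on a complex submanifold of `ℂⁿ`).
-/

noncomputable section

open scoped Topology InnerProductSpace
open Filter Module

namespace Literature.AlgebraicGeometry.HodgeTheory

section Calculus

variable {E : Type*} [NormedAddCommGroup E] [NormedSpace ℝ E]

/-! ### Second derivatives of sums and products at a point -/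

/-- For `C²` functions, `D(φψ) = φ Dψ + ψ Dφ` near the point. [folklore] -/
theorem fderiv_mul_eventuallyEq {φ ψ : E → ℝ} {x : E} (hφ : ContDiffAt ℝ 2 φ x)
    (hψ : ContDiffAt ℝ 2 ψ x) :
    (fun y => fderiv ℝ (fun z => φ z * ψ z) y) =ᶠ[𝓝 x]
      fun y => φ y • fderiv ℝ ψ y + ψ y • fderiv ℝ φ y := by
  filter_upwards [hφ.eventually (by simp), hψ.eventually (by simp)] with y hy hy'
  exact fderiv_fun_mul (hy.differentiableAt (by simp)) (hy'.differentiableAt (by simp))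

/-- For `C²` functions, `D(φ + ψ) = Dφ + Dψ` near the point. [folklore] -/
theorem fderiv_add_eventuallyEq {φ ψ : E → ℝ} {x : E} (hφ : ContDiffAt ℝ 2 φ x)
    (hψ : ContDiffAt ℝ 2 ψ x) :
    (fun y => fderiv ℝ (fun z => φ z + ψ z) y) =ᶠ[𝓝 x]
      fun y => fderiv ℝ φ y + fderiv ℝ ψ y := by
  filter_upwards [hφ.eventually (by simp), hψ.eventually (by simp)] with y hy hy'
  exact fderiv_fun_add (hy.differentiableAt (by simp)) (hy'.differentiableAt (by simp))

/-- The derivative of a `C²` function is differentiable. [folklore] -/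
theorem differentiableAt_fderiv_of_contDiffAt {φ : E → ℝ} {x : E} (hφ : ContDiffAt ℝ 2 φ x) :
    DifferentiableAt ℝ (fun y => fderiv ℝ φ y) x :=
  (hφ.fderiv_right (m := 1) le_rfl).differentiableAt (by simp)


/-- The derivative of a `C²` vector-valued function is differentiable. [folklore] -/
theorem differentiableAt_fderiv_of_contDiffAt' {F : Type*} [NormedAddCommGroup F] [NormedSpace ℝ F]
    {φ : E → F} {x : E} (hφ : ContDiffAt ℝ 2 φ x) :
    DifferentiableAt ℝ (fun y => fderiv ℝ φ y) x :=
  (hφ.fderiv_right (m := 1) le_rfl).differentiableAt (by simp)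

/-- **Second derivative of a sum**: `D²(φ + ψ)(u, v) = D²φ(u, v) + D²ψ(u, v)`. [folklore] -/
theorem fderiv_fderiv_add_apply {φ ψ : E → ℝ} {x : E} (hφ : ContDiffAt ℝ 2 φ x)
    (hψ : ContDiffAt ℝ 2 ψ x) (u v : E) :
    fderiv ℝ (fun y => fderiv ℝ (fun z => φ z + ψ z) y) x u v =
      fderiv ℝ (fun y => fderiv ℝ φ y) x u v + fderiv ℝ (fun y => fderiv ℝ ψ y) x u v := by
  rw [(fderiv_add_eventuallyEq hφ hψ).fderiv_eq,
    fderiv_fun_add (differentiableAt_fderiv_of_contDiffAt hφ)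
      (differentiableAt_fderiv_of_contDiffAt hψ)]
  rfl

/-- **Second derivative of a product**:
`D²(φψ)(u, v) = φ D²ψ(u, v) + ψ D²φ(u, v) + Dφ(u) Dψ(v) + Dψ(u) Dφ(v)`. [folklore] -/
theorem fderiv_fderiv_mul_apply {φ ψ : E → ℝ} {x : E} (hφ : ContDiffAt ℝ 2 φ x)
    (hψ : ContDiffAt ℝ 2 ψ x) (u v : E) :
    fderiv ℝ (fun y => fderiv ℝ (fun z => φ z * ψ z) y) x u v =
      φ x * fderiv ℝ (fun y => fderiv ℝ ψ y) x u v + ψ x * fderiv ℝ (fun y => fderiv ℝ φ y) x u v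
        + fderiv ℝ φ x u * fderiv ℝ ψ x v + fderiv ℝ ψ x u * fderiv ℝ φ x v := by
  rw [(fderiv_mul_eventuallyEq hφ hψ).fderiv_eq]
  have hdφ : DifferentiableAt ℝ φ x := hφ.differentiableAt (by simp)
  have hdψ : DifferentiableAt ℝ ψ x := hψ.differentiableAt (by simp)
  have hDφ := differentiableAt_fderiv_of_contDiffAt hφ
  have hDψ := differentiableAt_fderiv_of_contDiffAt hψ
  rw [fderiv_fun_add (show DifferentiableAt ℝ (fun y => φ y • fderiv ℝ ψ y) x from hdφ.smul hDψ)
    (show DifferentiableAt ℝ (fun y => ψ y • fderiv ℝ φ y) x from hdψ.smul hDφ),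
    fderiv_fun_smul hdφ hDψ, fderiv_fun_smul hdψ hDφ]
  simp only [FunLike.coe_add, Pi.add_apply, FunLike.coe_smul, Pi.smul_apply,
    ContinuousLinearMap.smulRight_apply, smul_eq_mul]
  ring

/-! ### The `J`-averaged Hessian numerator -/

/-- **The Levi numerator** `leviNum J φ x u = φ(x) (D²φₓ(u,u) + D²φₓ(Ju,Ju)) - (Dφₓ u)² - (Dφₓ Ju)²`
of a real function `φ` at `x` in the direction `u`, for an operator `J` (in the application,
multiplication by `i` in real coordinates; then `leviNum = 4 φ² · ∂∂̄(log φ)(u, ū)` for `φ > 0`):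
the quantity whose sign controls the `J`-averaged Hessian of quotients at critical points
(Voisin II, proof of Prop. 1.19). [cite: VoisinHodgeII2003, §1.2.1 proof of Prop. 1.19 (PDF p. 58)] -/
def leviNum (J : E →L[ℝ] E) (φ : E → ℝ) (x u : E) : ℝ :=
  φ x * (fderiv ℝ (fun y => fderiv ℝ φ y) x u u + fderiv ℝ (fun y => fderiv ℝ φ y) x (J u) (J u))
    - (fderiv ℝ φ x u) ^ 2 - (fderiv ℝ φ x (J u)) ^ 2

/-- Unfolding lemma for `leviNum`. [folklore] -/
theorem leviNum_def (J : E →L[ℝ] E) (φ : E → ℝ) (x u : E) :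
    leviNum J φ x u = φ x * (fderiv ℝ (fun y => fderiv ℝ φ y) x u u +
      fderiv ℝ (fun y => fderiv ℝ φ y) x (J u) (J u)) - (fderiv ℝ φ x u) ^ 2 -
        (fderiv ℝ φ x (J u)) ^ 2 :=
  rfl

/-- `leviNum` depends only on the germ of the function. [folklore] -/
theorem leviNum_congr_of_eventuallyEq (J : E →L[ℝ] E) {φ ψ : E → ℝ} {x : E} (h : φ =ᶠ[𝓝 x] ψ)
    (u : E) : leviNum J φ x u = leviNum J ψ x u := by
  have h1 : fderiv ℝ φ x = fderiv ℝ ψ x := h.fderiv_eq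
  have h2 : fderiv ℝ (fun y => fderiv ℝ φ y) x = fderiv ℝ (fun y => fderiv ℝ ψ y) x :=
    (h.fderiv).fderiv_eq
  rw [leviNum, leviNum, h1, h2, h.eq_of_nhds]

/-- **`leviNum (φψ) = φ² leviNum ψ + ψ² leviNum φ`** (`log (φψ) = log φ + log ψ`, in numerator
form valid without positivity). [folklore] -/
theorem leviNum_mul (J : E →L[ℝ] E) {φ ψ : E → ℝ} {x : E} (hφ : ContDiffAt ℝ 2 φ x)
    (hψ : ContDiffAt ℝ 2 ψ x) (u : E) :
    leviNum J (fun y => φ y * ψ y) x u = φ x ^ 2 * leviNum J ψ x u + ψ x ^ 2 * leviNum J φ x u := by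
  have hdφ : DifferentiableAt ℝ φ x := hφ.differentiableAt (by simp)
  have hdψ : DifferentiableAt ℝ ψ x := hψ.differentiableAt (by simp)
  simp only [leviNum, fderiv_fderiv_mul_apply hφ hψ, fderiv_fun_mul hdφ hdψ,
    FunLike.coe_add, Pi.add_apply, FunLike.coe_smul, Pi.smul_apply, smul_eq_mul]
  ring

/-- `leviNum` of a constant vanishes. [folklore] -/
theorem leviNum_const (J : E →L[ℝ] E) (c : ℝ) (x u : E) : leviNum J (fun _ => c) x u = 0 := by
  simp [leviNum]

/-- **`leviNum (φᵏ) ≥ 0` when `leviNum φ ≥ 0`** (`log φᵏ = k log φ`): by `leviNum_mul`,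
`leviNum (φ · φᵏ) = φ² leviNum (φᵏ) + φ²ᵏ leviNum φ`. [folklore] -/
theorem leviNum_pow_nonneg (J : E →L[ℝ] E) {φ : E → ℝ} {x : E} (hφ : ContDiffAt ℝ 2 φ x) (u : E)
    (h : 0 ≤ leviNum J φ x u) (k : ℕ) : 0 ≤ leviNum J (fun y => φ y ^ k) x u := by
  induction k with
  | zero => simp [leviNum_const]
  | succ k ih =>
    have hk : ContDiffAt ℝ 2 (fun y => φ y ^ k) x := hφ.pow k
    have heq : (fun y => φ y ^ (k + 1)) = fun y => φ y * φ y ^ k := by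
      funext y; ring
    rw [heq, leviNum_mul J hφ hk u]
    positivity

/-- **`leviNum (a² + b²) = 0` under the Cauchy–Riemann relations**: if at `x` the real functions
`a`, `b` satisfy `Da(Ju) = -Db(u)`, `Db(Ju) = Da(u)`, `D²a(Ju,Ju) = -D²a(u,u)`,
`D²b(Ju,Ju) = -D²b(u,u)` (as `a + ib = f` holomorphic in coordinates where `J` is multiplication by
`i`: `Df` is `ℂ`-linear and `D²f` is `ℂ`-bilinear), then `leviNum (a² + b²) = 0` at `(x, u)`:
`log |f|² = 2 Re log f` is pluriharmonic.  Here
`D²(a²+b²)(u,u) + D²(a²+b²)(Ju,Ju) = 4 ((Da u)² + (Db u)²)` and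
`(D(a²+b²) u)² + (D(a²+b²) Ju)² = 4 (a² + b²) ((Da u)² + (Db u)²)`. [folklore] -/
theorem leviNum_sq_add_sq_eq_zero (J : E →L[ℝ] E) {a b : E → ℝ} {x : E} (ha : ContDiffAt ℝ 2 a x)
    (hb : ContDiffAt ℝ 2 b x) (u : E)
    (h1a : fderiv ℝ a x (J u) = -fderiv ℝ b x u) (h1b : fderiv ℝ b x (J u) = fderiv ℝ a x u)
    (h2a : fderiv ℝ (fun y => fderiv ℝ a y) x (J u) (J u) = -fderiv ℝ (fun y => fderiv ℝ a y) x u u)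
    (h2b : fderiv ℝ (fun y => fderiv ℝ b y) x (J u) (J u) = -fderiv ℝ (fun y => fderiv ℝ b y) x u u) :
    leviNum J (fun y => a y ^ 2 + b y ^ 2) x u = 0 := by
  have ha2 : ContDiffAt ℝ 2 (fun y => a y ^ 2) x := ha.pow 2
  have hb2 : ContDiffAt ℝ 2 (fun y => b y ^ 2) x := hb.pow 2
  have hda : DifferentiableAt ℝ a x := ha.differentiableAt (by simp)
  have hdb : DifferentiableAt ℝ b x := hb.differentiableAt (by simp)
  have hsqa : (fun y => a y ^ 2) = fun y => a y * a y := by funext y; ring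
  have hsqb : (fun y => b y ^ 2) = fun y => b y * b y := by funext y; ring
  have hD1 : ∀ w, fderiv ℝ (fun y => a y ^ 2 + b y ^ 2) x w =
      2 * a x * fderiv ℝ a x w + 2 * b x * fderiv ℝ b x w := by
    intro w
    rw [fderiv_fun_add (ha2.differentiableAt (by simp)) (hb2.differentiableAt (by simp)), hsqa, hsqb,
      fderiv_fun_mul hda hda, fderiv_fun_mul hdb hdb]
    simp only [FunLike.coe_add, Pi.add_apply, FunLike.coe_smul, Pi.smul_apply, smul_eq_mul]
    ring
  have hD2 : ∀ w, fderiv ℝ (fun y => fderiv ℝ (fun z => a z ^ 2 + b z ^ 2) y) x w w =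
      2 * (fderiv ℝ a x w) ^ 2 + 2 * a x * fderiv ℝ (fun y => fderiv ℝ a y) x w w +
        (2 * (fderiv ℝ b x w) ^ 2 + 2 * b x * fderiv ℝ (fun y => fderiv ℝ b y) x w w) := by
    intro w
    rw [fderiv_fderiv_add_apply ha2 hb2, hsqa, hsqb, fderiv_fderiv_mul_apply ha ha,
      fderiv_fderiv_mul_apply hb hb]
    ring
  rw [leviNum, hD1, hD1, hD2, hD2, h1a, h1b, h2a, h2b]
  ring

/-- **The `J`-averaged Hessian of a quotient at a critical point**: let `N = h · P` near `x`, with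
`h`, `P` of class `C²` at `x`, `h(x) > 0`, `P(x) > 0`, `Dh(x) = 0`.  If `leviNum P = 0` and
`leviNum N > 0` at `(x, u)`, then `D²hₓ(u, u) + D²hₓ(Ju, Ju) > 0` — because
`leviNum N = h² leviNum P + P² leviNum h = P² h (D²h(u,u) + D²h(Ju,Ju))` at a critical point.  This
is how the index of `g = (z^*Az)(z^*z)^{d-1}/|F|²` on `{F ≠ 0}` is bounded (Voisin II, proof of
Prop. 1.19 and Thm. 1.22). [cite: VoisinHodgeII2003, §1.2.1 Prop. 1.19, §1.2.2 Thm. 1.22 (PDF pp. 58–59)] -/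
theorem hessian_add_hessian_pos_of_isCriticalPt (J : E →L[ℝ] E) {N h P : E → ℝ} {x : E}
    (hh : ContDiffAt ℝ 2 h x) (hP : ContDiffAt ℝ 2 P x) (hN : N =ᶠ[𝓝 x] fun y => h y * P y)
    (hhx : 0 < h x) (hPx : 0 < P x) (hcrit : fderiv ℝ h x = 0) (u : E)
    (hLP : leviNum J P x u = 0) (hLN : 0 < leviNum J N x u) :
    0 < fderiv ℝ (fun y => fderiv ℝ h y) x u u + fderiv ℝ (fun y => fderiv ℝ h y) x (J u) (J u) := by
  rw [leviNum_congr_of_eventuallyEq J hN u, leviNum_mul J hh hP u, hLP, mul_zero, zero_add] at hLN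
  have hLh : leviNum J h x u = h x * (fderiv ℝ (fun y => fderiv ℝ h y) x u u +
      fderiv ℝ (fun y => fderiv ℝ h y) x (J u) (J u)) := by
    simp [leviNum, hcrit]
  rw [hLh, ← mul_assoc] at hLN
  exact pos_of_mul_pos_right hLN (by positivity)

end Calculus


/-! ### `|G|²` for `G` holomorphic in real coordinates -/

section Holomorphic

variable {E : Type*} [NormedAddCommGroup E] [NormedSpace ℝ E]

/-- `D(Re G) = Re DG`. [folklore] -/
theorem fderiv_re_comp_apply {G : E → ℂ} {x : E} (hG : DifferentiableAt ℝ G x) (u : E) :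
    fderiv ℝ (fun y => (G y).re) x u = (fderiv ℝ G x u).re := by
  have h : HasFDerivAt (fun y => (G y).re) (Complex.reCLM.comp (fderiv ℝ G x)) x :=
    Complex.reCLM.hasFDerivAt.comp x hG.hasFDerivAt
  rw [h.fderiv]; rfl

/-- `D(Im G) = Im DG`. [folklore] -/
theorem fderiv_im_comp_apply {G : E → ℂ} {x : E} (hG : DifferentiableAt ℝ G x) (u : E) :
    fderiv ℝ (fun y => (G y).im) x u = (fderiv ℝ G x u).im := by
  have h : HasFDerivAt (fun y => (G y).im) (Complex.imCLM.comp (fderiv ℝ G x)) x :=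
    Complex.imCLM.hasFDerivAt.comp x hG.hasFDerivAt
  rw [h.fderiv]; rfl

/-- `D²(Re G) = Re D²G` for `G` of class `C²`. [folklore] -/
theorem fderiv_fderiv_re_comp_apply {G : E → ℂ} {x : E} (hG : ContDiffAt ℝ 2 G x) (u v : E) :
    fderiv ℝ (fun y => fderiv ℝ (fun z => (G z).re) y) x u v =
      (fderiv ℝ (fun y => fderiv ℝ G y) x u v).re := by
  have hev : (fun y => fderiv ℝ (fun z => (G z).re) y) =ᶠ[𝓝 x]
      fun y => (ContinuousLinearMap.compL ℝ E ℂ ℝ Complex.reCLM) (fderiv ℝ G y) := by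
    filter_upwards [hG.eventually (by simp)] with y hy
    have h : HasFDerivAt (fun z => (G z).re) (Complex.reCLM.comp (fderiv ℝ G y)) y :=
      Complex.reCLM.hasFDerivAt.comp y (hy.differentiableAt (by simp)).hasFDerivAt
    exact h.fderiv
  have h2 : HasFDerivAt (fun y => (ContinuousLinearMap.compL ℝ E ℂ ℝ Complex.reCLM) (fderiv ℝ G y))
      ((ContinuousLinearMap.compL ℝ E ℂ ℝ Complex.reCLM).comp (fderiv ℝ (fun y => fderiv ℝ G y) x)) x :=
    (ContinuousLinearMap.compL ℝ E ℂ ℝ Complex.reCLM).hasFDerivAt.comp x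
      (differentiableAt_fderiv_of_contDiffAt' hG).hasFDerivAt
  rw [hev.fderiv_eq, h2.fderiv]
  rfl

/-- `D²(Im G) = Im D²G` for `G` of class `C²`. [folklore] -/
theorem fderiv_fderiv_im_comp_apply {G : E → ℂ} {x : E} (hG : ContDiffAt ℝ 2 G x) (u v : E) :
    fderiv ℝ (fun y => fderiv ℝ (fun z => (G z).im) y) x u v =
      (fderiv ℝ (fun y => fderiv ℝ G y) x u v).im := by
  have hev : (fun y => fderiv ℝ (fun z => (G z).im) y) =ᶠ[𝓝 x]
      fun y => (ContinuousLinearMap.compL ℝ E ℂ ℝ Complex.imCLM) (fderiv ℝ G y) := by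
    filter_upwards [hG.eventually (by simp)] with y hy
    have h : HasFDerivAt (fun z => (G z).im) (Complex.imCLM.comp (fderiv ℝ G y)) y :=
      Complex.imCLM.hasFDerivAt.comp y (hy.differentiableAt (by simp)).hasFDerivAt
    exact h.fderiv
  have h2 : HasFDerivAt (fun y => (ContinuousLinearMap.compL ℝ E ℂ ℝ Complex.imCLM) (fderiv ℝ G y))
      ((ContinuousLinearMap.compL ℝ E ℂ ℝ Complex.imCLM).comp (fderiv ℝ (fun y => fderiv ℝ G y) x)) x :=
    (ContinuousLinearMap.compL ℝ E ℂ ℝ Complex.imCLM).hasFDerivAt.comp x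
      (differentiableAt_fderiv_of_contDiffAt' hG).hasFDerivAt
  rw [hev.fderiv_eq, h2.fderiv]
  rfl

/-- **`leviNum |G|² = 0` for `G` holomorphic to second order at `x` in the direction `u`**: if
`DG(Ju) = i DG(u)` and `D²G(Ju, Ju) = -D²G(u, u)` (real derivatives of the complex-valued `C²`
function `G`), then `leviNum (|G|²) = 0` at `(x, u)` (`log |G|²` is pluriharmonic).
[cite: VoisinHodgeII2003, §1.2.1 proof of Prop. 1.19 (PDF p. 58)] -/
theorem leviNum_normSq_eq_zero (J : E →L[ℝ] E) {G : E → ℂ} {x : E} (hG : ContDiffAt ℝ 2 G x)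
    (u : E) (h1 : fderiv ℝ G x (J u) = Complex.I * fderiv ℝ G x u)
    (h2 : fderiv ℝ (fun y => fderiv ℝ G y) x (J u) (J u) = -fderiv ℝ (fun y => fderiv ℝ G y) x u u) :
    leviNum J (fun y => ‖G y‖ ^ 2) x u = 0 := by
  have heq : (fun y => ‖G y‖ ^ 2) = fun y => (G y).re ^ 2 + (G y).im ^ 2 := by
    funext y; rw [Complex.sq_norm, Complex.normSq_apply]; ring
  have hre : ContDiffAt ℝ 2 (fun y => (G y).re) x := Complex.reCLM.contDiff.contDiffAt.comp x hG
  have him : ContDiffAt ℝ 2 (fun y => (G y).im) x := Complex.imCLM.contDiff.contDiffAt.comp x hG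
  have hd : DifferentiableAt ℝ G x := hG.differentiableAt (by simp)
  rw [heq]
  refine leviNum_sq_add_sq_eq_zero J hre him u ?_ ?_ ?_ ?_
  · rw [fderiv_re_comp_apply hd, fderiv_im_comp_apply hd, h1]; simp
  · rw [fderiv_re_comp_apply hd, fderiv_im_comp_apply hd, h1]; simp
  · rw [fderiv_fderiv_re_comp_apply hG, fderiv_fderiv_re_comp_apply hG, h2]; simp
  · rw [fderiv_fderiv_im_comp_apply hG, fderiv_fderiv_im_comp_apply hG, h2]; simp

variable {V : Type*} [NormedAddCommGroup V] [NormedSpace ℂ V]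

/-- The real derivative of `G = g ∘ A`, `g` complex-differentiable, `A` real-linear:
`DG_y = D_ℂ g (A y) ∘ A`. [folklore] -/
theorem hasFDerivAt_comp_clm_of_differentiable {g : V → ℂ} (hg : Differentiable ℂ g)
    (A : E →L[ℝ] V) (y : E) :
    HasFDerivAt (fun z => g (A z)) (((fderiv ℂ g (A y)).restrictScalars ℝ).comp A) y :=
  ((hg (A y)).hasFDerivAt.restrictScalars ℝ).comp y A.hasFDerivAt

/-- **Holomorphy in real coordinates, first order**: for `G = g ∘ A` with `g` complex
differentiable, `A` real-linear and `A (J u) = i · A u`, `DG_x(J u) = i · DG_x(u)`. [folklore] -/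
theorem fderiv_comp_clm_apply_J {g : V → ℂ} (hg : Differentiable ℂ g) (A : E →L[ℝ] V)
    (J : E →L[ℝ] E) {x u : E} (hJ : A (J u) = Complex.I • A u) :
    fderiv ℝ (fun z => g (A z)) x (J u) = Complex.I * fderiv ℝ (fun z => g (A z)) x u := by
  rw [(hasFDerivAt_comp_clm_of_differentiable hg A x).fderiv]
  simp only [ContinuousLinearMap.comp_apply, ContinuousLinearMap.coe_restrictScalars', hJ,
    map_smul, smul_eq_mul]

/-- **Holomorphy in real coordinates, second order**: for `G = g ∘ A` with `g` twice complex
differentiable, `A` real-linear and `A (J u) = i · A u`, `D²G_x(Ju, Ju) = -D²G_x(u, u)`, and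
`G` is `C²`. [folklore] -/
theorem fderiv_fderiv_comp_clm_apply_J {g : V → ℂ} (hg : ContDiff ℂ 2 g) (A : E →L[ℝ] V)
    (J : E →L[ℝ] E) {x u : E} (hJ : A (J u) = Complex.I • A u) :
    fderiv ℝ (fun y => fderiv ℝ (fun z => g (A z)) y) x (J u) (J u) =
      -fderiv ℝ (fun y => fderiv ℝ (fun z => g (A z)) y) x u u := by
  have hd : Differentiable ℂ g := hg.differentiable (by simp)
  have hd2 : Differentiable ℂ (fderiv ℂ g) := (hg.fderiv_right (m := 1) le_rfl).differentiable (by simp)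
  -- `DG = Ψ ∘ (D_ℂ g) ∘ A` with `Ψ T = T|_ℝ ∘ A` real-linear continuous
  set Ψ : (V →L[ℂ] ℂ) →L[ℝ] E →L[ℝ] ℂ :=
    ((ContinuousLinearMap.compL ℝ E V ℂ).flip A).comp
      (ContinuousLinearMap.restrictScalarsL ℂ V ℂ ℝ ℝ) with hΨ
  have hΨapp : ∀ T : V →L[ℂ] ℂ, Ψ T = (T.restrictScalars ℝ).comp A := fun T => rfl
  have hD : (fun y => fderiv ℝ (fun z => g (A z)) y) = fun y => Ψ (fderiv ℂ g (A y)) := by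
    funext y
    rw [(hasFDerivAt_comp_clm_of_differentiable hd A y).fderiv, hΨapp]
  have hin : HasFDerivAt (fun y => fderiv ℂ g (A y))
      (((fderiv ℂ (fderiv ℂ g) (A x)).restrictScalars ℝ).comp A) x :=
    ((hd2 (A x)).hasFDerivAt.restrictScalars ℝ).comp x A.hasFDerivAt
  have h3 : HasFDerivAt (fun y => Ψ (fderiv ℂ g (A y)))
      (Ψ.comp (((fderiv ℂ (fderiv ℂ g) (A x)).restrictScalars ℝ).comp A)) x :=
    Ψ.hasFDerivAt.comp x hin
  rw [hD, h3.fderiv]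
  simp only [ContinuousLinearMap.comp_apply, ContinuousLinearMap.coe_restrictScalars', hΨapp, hJ,
    map_smul, FunLike.coe_smul, Pi.smul_apply, smul_eq_mul, ← mul_assoc, Complex.I_mul_I]
  ring

/-- `G = g ∘ A` is real `C²` if `g` is complex `C²`. [folklore] -/
theorem contDiff_comp_clm_real {g : V → ℂ} (hg : ContDiff ℂ 2 g) (A : E →L[ℝ] V) :
    ContDiff ℝ 2 (fun z => g (A z)) :=
  (hg.restrict_scalars ℝ).comp A.contDiff

/-- **`leviNum |g ∘ A|² = 0`** for `g` complex `C²` (e.g. a polynomial), `A` real-linear with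
`A (J u) = i · A u`: `log |g|²` is pluriharmonic. [cite: VoisinHodgeII2003, §1.2.1 proof of Prop. 1.19 (PDF p. 58)] -/
theorem leviNum_normSq_comp_clm_eq_zero (J : E →L[ℝ] E) {g : V → ℂ} (hg : ContDiff ℂ 2 g)
    (A : E →L[ℝ] V) {x u : E} (hJ : A (J u) = Complex.I • A u) :
    leviNum J (fun y => ‖g (A y)‖ ^ 2) x u = 0 :=
  leviNum_normSq_eq_zero J (contDiff_comp_clm_real hg A).contDiffAt u
    (fderiv_comp_clm_apply_J (hg.differentiable (by simp)) A J hJ)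
    (fderiv_fderiv_comp_clm_apply_J hg A J hJ)

end Holomorphic

/-! ### `‖affine‖²` into a complex inner product space -/

section NormSq

variable {E : Type*} [NormedAddCommGroup E] [NormedSpace ℝ E]
  {H : Type*} [NormedAddCommGroup H] [InnerProductSpace ℂ H]

/-- The real inner product `Re ⟪·, ·⟫_ℂ` underlying a complex inner product space (Mathlib's
`InnerProductSpace.rclikeToReal`, registered locally). [folklore] -/
local instance instInnerProductSpaceRealOfComplex : InnerProductSpace ℝ H :=
  InnerProductSpace.rclikeToReal ℂ H

omit [NormedSpace ℝ E] in
/-- The underlying real inner product is the real part of the complex one (definitional).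
[folklore] -/
theorem real_inner_eq_re_inner' (v w : H) : ⟪v, w⟫_ℝ = (⟪v, w⟫_ℂ).re := rfl

/-- The derivative of `q = ‖b + L ·‖²` is `Dq_y = 2 ⟪b + L y, L ·⟫_ℝ`. [folklore] -/
theorem hasFDerivAt_norm_sq_affine (b : H) (L : E →L[ℝ] H) (y : E) :
    HasFDerivAt (fun z => ‖b + L z‖ ^ 2) ((2 : ℝ) • (innerSL ℝ (b + L y)).comp L) y := by
  convert ((L.hasFDerivAt).const_add b).norm_sq using 1
  ext u
  simp [two_smul]

/-- `q = ‖b + L ·‖²` is smooth. [folklore] -/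
theorem contDiff_norm_sq_affine (b : H) (L : E →L[ℝ] H) {n : WithTop ℕ∞} :
    ContDiff ℝ n (fun z => ‖b + L z‖ ^ 2) :=
  (contDiff_norm_sq ℂ (n := n)).comp (contDiff_const.add L.contDiff)

/-- First derivative of `q = ‖b + L ·‖²`: `Dq_y(u) = 2 Re ⟪b + L y, L u⟫_ℂ`. [folklore] -/
theorem fderiv_norm_sq_affine_apply (b : H) (L : E →L[ℝ] H) (y u : E) :
    fderiv ℝ (fun z => ‖b + L z‖ ^ 2) y u = 2 * (⟪b + L y, L u⟫_ℂ).re := by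
  rw [(hasFDerivAt_norm_sq_affine b L y).fderiv]
  simp only [FunLike.coe_smul, Pi.smul_apply, ContinuousLinearMap.comp_apply,
    innerSL_apply_apply, smul_eq_mul]
  rfl

/-- The derivative of `q = ‖b + L ·‖²` as a function of the point: `y ↦ B (b + L y)` with
`B v = 2 ⟪v, L ·⟫_ℝ` continuous linear in `v`. [folklore] -/
theorem fderiv_norm_sq_affine_eq (b : H) (L : E →L[ℝ] H) :
    (fun y => fderiv ℝ (fun z => ‖b + L z‖ ^ 2) y) = fun y =>
      ((2 : ℝ) • ((ContinuousLinearMap.compL ℝ E H ℝ).flip L).comp (innerSL ℝ (E := H))) (b + L y) := by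
  funext y
  rw [(hasFDerivAt_norm_sq_affine b L y).fderiv]
  ext u
  simp only [FunLike.coe_smul, Pi.smul_apply, ContinuousLinearMap.comp_apply,
    ContinuousLinearMap.flip_apply, ContinuousLinearMap.compL_apply]

/-- Second derivative of `q = ‖b + L ·‖²`: `D²q_y(u, v) = 2 Re ⟪L u, L v⟫_ℂ`. [folklore] -/
theorem fderiv_fderiv_norm_sq_affine_apply (b : H) (L : E →L[ℝ] H) (y u v : E) :
    fderiv ℝ (fun z => fderiv ℝ (fun w => ‖b + L w‖ ^ 2) z) y u v = 2 * (⟪L u, L v⟫_ℂ).re := by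
  set B : H →L[ℝ] E →L[ℝ] ℝ :=
    (2 : ℝ) • ((ContinuousLinearMap.compL ℝ E H ℝ).flip L).comp (innerSL ℝ (E := H)) with hB
  have hΦ : HasFDerivAt (fun z => b + L z) L y := (L.hasFDerivAt).const_add b
  have h2 : HasFDerivAt (fun z => B (b + L z)) (B.comp L) y := B.hasFDerivAt.comp y hΦ
  rw [fderiv_norm_sq_affine_eq, h2.fderiv]
  simp only [hB, ContinuousLinearMap.comp_apply, FunLike.coe_smul, Pi.smul_apply,
    ContinuousLinearMap.flip_apply, ContinuousLinearMap.compL_apply, innerSL_apply_apply, smul_eq_mul]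
  rfl

/-- **`leviNum ‖b + L ·‖² = 4 (‖b + L x‖² ‖L u‖² - |⟪b + L x, L u⟫|²)`** when `L (J u) = i · L u`
(Voisin II, proof of Prop. 1.19: the Hessian of `h ∘ φ` is `2(⟨0x, Φ(u,v)⟩ + ⟨u, v⟩)`; here for the
Fubini–Study potential `log ‖·‖²_A`, whose Levi form is `(‖x‖²‖u‖² - |⟨x,u⟩|²)/‖x‖⁴`).
[cite: VoisinHodgeII2003, §1.2.1 proof of Prop. 1.19 (PDF p. 58)] -/
theorem leviNum_norm_sq_affine (J : E →L[ℝ] E) (b : H) (L : E →L[ℝ] H) (x u : E)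
    (hJ : L (J u) = Complex.I • L u) :
    leviNum J (fun z => ‖b + L z‖ ^ 2) x u =
      4 * (‖b + L x‖ ^ 2 * ‖L u‖ ^ 2 - ‖⟪b + L x, L u⟫_ℂ‖ ^ 2) := by
  have hre : (⟪L u, L u⟫_ℂ).re = ‖L u‖ ^ 2 := by
    rw [inner_self_eq_norm_sq_to_K]; norm_cast
  have hJJ : ⟪Complex.I • L u, Complex.I • L u⟫_ℂ = ⟪L u, L u⟫_ℂ := by
    rw [inner_smul_left, inner_smul_right, Complex.conj_I, ← mul_assoc]
    simp
  have hJz : (⟪b + L x, Complex.I • L u⟫_ℂ).re = -(⟪b + L x, L u⟫_ℂ).im := by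
    rw [inner_smul_right, Complex.mul_re, Complex.I_re, Complex.I_im]; ring
  have hnorm : ‖⟪b + L x, L u⟫_ℂ‖ ^ 2 = (⟪b + L x, L u⟫_ℂ).re ^ 2 + (⟪b + L x, L u⟫_ℂ).im ^ 2 := by
    rw [Complex.sq_norm, Complex.normSq_apply]; ring
  rw [leviNum, fderiv_fderiv_norm_sq_affine_apply, fderiv_fderiv_norm_sq_affine_apply,
    fderiv_norm_sq_affine_apply, fderiv_norm_sq_affine_apply, hJ, hJJ, hre, hJz, hnorm]
  ring

/-- **`leviNum ‖b + L ·‖² ≥ 0`** (Cauchy–Schwarz). [folklore] -/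
theorem leviNum_norm_sq_affine_nonneg (J : E →L[ℝ] E) (b : H) (L : E →L[ℝ] H) (x u : E)
    (hJ : L (J u) = Complex.I • L u) : 0 ≤ leviNum J (fun z => ‖b + L z‖ ^ 2) x u := by
  rw [leviNum_norm_sq_affine J b L x u hJ]
  have h := norm_inner_le_norm (𝕜 := ℂ) (b + L x) (L u)
  have h0 : 0 ≤ ‖⟪b + L x, L u⟫_ℂ‖ := norm_nonneg _
  have h' : ‖⟪b + L x, L u⟫_ℂ‖ ^ 2 ≤ (‖b + L x‖ * ‖L u‖) ^ 2 := pow_le_pow_left₀ h0 h 2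
  nlinarith [h']

/-- **`leviNum ‖b + L ·‖² > 0` when `b + L x` and `L u` are `ℂ`-linearly independent** (equality
case of Cauchy–Schwarz; Voisin's positive term `⟨u, u⟩` in `Hess_x f`).
[cite: VoisinHodgeII2003, §1.2.1 proof of Prop. 1.19 (PDF p. 58)] -/
theorem leviNum_norm_sq_affine_pos (J : E →L[ℝ] E) (b : H) (L : E →L[ℝ] H) (x u : E)
    (hJ : L (J u) = Complex.I • L u) (hx : b + L x ≠ 0) (hu : L u ≠ 0)
    (hind : ∀ r : ℂ, L u ≠ r • (b + L x)) : 0 < leviNum J (fun z => ‖b + L z‖ ^ 2) x u := by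
  rw [leviNum_norm_sq_affine J b L x u hJ]
  have hle := norm_inner_le_norm (𝕜 := ℂ) (b + L x) (L u)
  have hne : ‖⟪b + L x, L u⟫_ℂ‖ ≠ ‖b + L x‖ * ‖L u‖ := by
    intro heq
    obtain ⟨r, -, hr⟩ := (norm_inner_eq_norm_iff hx hu).1 heq
    exact hind r hr
  have hlt : ‖⟪b + L x, L u⟫_ℂ‖ < ‖b + L x‖ * ‖L u‖ := lt_of_le_of_ne hle hne
  have h0 : 0 ≤ ‖⟪b + L x, L u⟫_ℂ‖ := norm_nonneg _
  have h' : ‖⟪b + L x, L u⟫_ℂ‖ ^ 2 < (‖b + L x‖ * ‖L u‖) ^ 2 := pow_lt_pow_left₀ hlt h0 two_ne_zero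
  nlinarith [h']

end NormSq

/-! ### Voisin II, Lemma 1.20 in index form -/

section Signature

variable {E : Type*} [AddCommGroup E] [Module ℝ E] [FiniteDimensional ℝ E]

omit [FiniteDimensional ℝ E] in
/-- **A negative-definite subspace meets its image under `J` trivially** when
`Q u + Q (J u) > 0` for all `u ≠ 0` (mechanism of Voisin II Lemma 1.20). [cite: VoisinHodgeII2003, §1.2.1 Lemma 1.20 (PDF p. 58)] -/
theorem inf_map_eq_bot_of_pos (Q : QuadraticForm ℝ E) (J : E ≃ₗ[ℝ] E)
    (hQ : ∀ u : E, u ≠ 0 → 0 < Q u + Q (J u)) {V : Submodule ℝ E} (hV : ((-Q).restrict V).PosDef) :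
    V ⊓ V.map (J : E →ₗ[ℝ] E) = ⊥ := by
  rw [Submodule.eq_bot_iff]
  rintro x ⟨hxV, hxJ⟩
  obtain ⟨y, hyV, rfl⟩ := Submodule.mem_map.1 hxJ
  by_contra hx
  have hy : y ≠ 0 := by
    rintro rfl; exact hx (map_zero _)
  have h1 : 0 < Q y + Q (J y) := hQ y hy
  have h2 : 0 < (-Q) y := by simpa using hV ⟨y, hyV⟩ (by simpa using hy)
  have h3 : 0 < (-Q) (J y) := by
    have := hV ⟨(J : E →ₗ[ℝ] E) y, hxV⟩ (by simpa using hx)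
    simpa using this
  simp only [QuadraticMap.neg_apply] at h2 h3
  linarith

/-- **Voisin II, Lemma 1.20 in index form**: if `Q u + Q (J u) > 0` for all `u ≠ 0`, with `J` a
linear automorphism of the finite-dimensional real space `E`, then `2 · sigNeg Q ≤ dim_ℝ E` (a
maximal negative-definite subspace `V` has `V ∩ J V = 0`).  With `J` multiplication by `i` and
`dim_ℝ E = 2n`: at most `n` negative directions (Prop. 1.19).
[cite: VoisinHodgeII2003, §1.2.1 Prop. 1.19 and Lemma 1.20 (PDF p. 58)] -/
theorem two_mul_sigNeg_le_finrank (Q : QuadraticForm ℝ E) (J : E ≃ₗ[ℝ] E)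
    (hQ : ∀ u : E, u ≠ 0 → 0 < Q u + Q (J u)) : 2 * sigNeg Q ≤ finrank ℝ E := by
  obtain ⟨V, hVr, hV⟩ := exists_finrank_eq_sigNeg_and_negDef Q
  have hbot := inf_map_eq_bot_of_pos Q J hQ hV
  have hsum := Submodule.finrank_sup_add_finrank_inf_eq V (V.map (J : E →ₗ[ℝ] E))
  rw [hbot, finrank_bot, add_zero, LinearEquiv.finrank_map_eq] at hsum
  have hle : finrank ℝ ↥(V ⊔ V.map (J : E →ₗ[ℝ] E)) ≤ finrank ℝ E := Submodule.finrank_le _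
  omega


/-- **The index bound for a Hessian** (Voisin II, Prop. 1.19 in the form used for Morse indices):
if `D²hₓ(u, u) + D²hₓ(Ju, Ju) > 0` for all `u ≠ 0`, with `J` a linear automorphism of the
finite-dimensional real normed space `E`, then the Hessian of `h` at `x`, as the bilinear form
`(u, v) ↦ D²hₓ(u)(v)` (the tree's `mhessian` in a chart), has `2 · sigNeg ≤ dim_ℝ E`.
[cite: VoisinHodgeII2003, §1.2.1 Prop. 1.19 and Lemma 1.20 (PDF p. 58)] -/
theorem two_mul_sigNeg_hessian_le_finrank {E : Type*} [NormedAddCommGroup E] [NormedSpace ℝ E]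
    [FiniteDimensional ℝ E] (J : E ≃L[ℝ] E) {h : E → ℝ} {x : E}
    (hpos : ∀ u : E, u ≠ 0 → 0 < fderiv ℝ (fun y => fderiv ℝ h y) x u u +
      fderiv ℝ (fun y => fderiv ℝ h y) x (J u) (J u)) :
    2 * sigNeg (LinearMap.BilinMap.toQuadraticMap ((ContinuousLinearMap.coeLM ℝ).comp
        (fderiv ℝ (fun y => fderiv ℝ h y) x).toLinearMap)) ≤ finrank ℝ E :=
  two_mul_sigNeg_le_finrank _ (J : E ≃ₗ[ℝ] E) fun u hu => hpos u hu

end Signature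

end Literature.AlgebraicGeometry.HodgeTheory
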